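/-
Copyright (c) 2026 the pub-hodgecm-mathlib formalisation cell (harness21).  Prover seat hodgecm-mathlib-LH4-p16 (g0), req620 Track A «(D-RAM) FOUR-FRAME» squad
(STAGE-1b, row (2) of the piece `f_{T₊}`, the (β₂) road under heir LEAD F0P3a-plan (g21) T20-18∕T20-19 (R-36) «PURE-CELL LEDGER, RELATIVE SIGNS»; β₂ sub-dealer
LH4-p04 (g8) BETA2-BOARD v1.1 row (L-K) «the near cell `K₀` against the diagonal cell `D`»; MECH-K0 v1 67ac68e4), 2026-09-04.
-/
import Summits.HodgeConjecture.HodgeConjecture.Theorems.F0P3cDyRamNormFormRayDominated   -- ★ p861653 (this seat): `hsmall_of_isOrd`; brings ★ p861454 `trace_mul_norm_map_eq`, ★ p861372 HEAD B + `v_thicken_iff_map`, ★ DEFS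
import Summits.HodgeConjecture.HodgeConjecture.Theorems.F0P3cDyRamDiagonalCellLetter     -- ★ p861637 (LH4-p19 (g0)): `v_inv_mul_sub_add_le_one_iff`, `exists_v_le_one_mul_unit_iff`, `v_add_map_le_of_le`, `inv_add_map_inv_eq_map_pairing`, `isOrd_zero`
import HarnessLib

/-!
# Crux `H413`, line LH4 «(D-RAM) FOUR-FRAME» — STAGE-1b, row (2), the (β₂) road (R-36), row (L-K): «THE LETTER OF A RAY-DOMINATED CELL IS `(f·h_W) • X₊`» — on ANY cone
# cell whose depth multiplier is order-integral and `E`-dominated at the scale of the cell (the diagonal cell `D = (b, b)` AND the near cell `K₀ = (b+1, b)`, at a place of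
# ANY type — no valuation letter of the cell is used), the census value set of every integral glued vertex is `valueSetMod σ ϖ m ((f·h_W) • X₊)` with the SAME `σ`-fixed
# scalar `f` (read off `lam − jE u₀₀` and the tube depth `b` only) times the line entry `h_W`: so `K₀` is pure with the sign of `D` — (L-K) in the deep regime

Cell `hodgecm-mathlib` (D-0151), FLOOR 0, crux item H413 = `stmt-HodgeConjecture-24833`, route of record `HCCMUnconditional`; squad F0∕P3c∕LH4; lane
`--supports stmt-HodgeConjecture-24833 --as helper` (count-neutral; pays NO tier-0 row).  THEOREMS ONLY (no `def`, no instance, no notation, no `sorry`, default heartbeats);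
★-only imports; states NO law; (β₂) stays a HYPOTHESIS.  DATUM-FREE: the plane `(E², H₂)` with `σ` isometric, `|ϖ| = exp(−1)`, block form `H = block(H₂, h_W)`,
`Γ = endoGL (γ₂, u)`, ★ (C1)'s line model `(M, jE, ρ, Θ; φ, lam, h_M)`, the `ρ`-datum ∕ order letters of ★ DEFS `F0P3cDyRamToricCensusDefs` (`IsOrd`, `dualGen`), ★ p861372's
glue ∕ generator letters; no residue field, no `|2|`, NO VALUATION OF `Y`, `cc(α − ρα)` OR `D₀` — this is the point.

WHY (MECH-K0 v1 §0–§2; LH4-cdis1 (g0) 15:32:52Z RamM table (κ-b) «`K₀,ℓ = +D_ℓ` at `δ ≥ 8`»; LH4-p19 (g0) ★ p861637 (L-D×)).  ★ p861637 proves «the letter of the DIAGONAL cell is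
`(f·h_W) • X₊`» from the valuation letters of `D` at a type-U place (`|Y| = |cc(α − ρα)| = |jEϖ|^b`, `m ≤ 2b`, the trace letter `htrace`): the cross terms of the norm form die by
SIZE.  On the near cell `K₀ = (b+1, b)` (order level one above the tube depth) and on every RamM cell those letters change (`|cc(α − ρα)| = |jEϖ|^{j}·|α − ρα|`), but the
conclusion does not, because the cross terms die for a different reason — DUALITY (★ p861653): with `Λ = x₀·𝒪_cc` INTEGRAL (`Y = dualGen x₀ ∈ 𝒪_cc`) and the depth multiplier
`μ = lam − jE u₀₀ = jE(ϖ^{m′})·μ̃`, `μ̃ ∈ 𝒪_cc`, `m ≤ m′`, the `ζ`-part of every value `Tr_ρ(μ·N_Θ(Yζ + jE a)∕D₀)` (`D₀ = cc(α − ρα)·ΘY`) is a sum of three hermitian pairings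
`Λ × ϖ^{m′}Λ^♯ → 𝔭^{m′}` (★ p861653 `hsmall_of_isOrd`), so the letter IS the thickened `a`-ray `{Tr_ρ(μ∕D₀)·jE(N a)}`.  The ray scalar is then read off the GLUE:
`Tr_ρ(D₀⁻¹) = jE⟨w₀, w₀⟩_{H₂}` (★ p861637 `inv_add_map_inv_eq_map_pairing`), `⟨w₀, w₀⟩_{H₂} = ⟨g₀, g₀⟩_H − σ(g₀ 1)·h_W·(g₀ 1)` with `⟨g₀, g₀⟩_H ∈ 𝒪` (★ p861015
`pairing_self_eq_plane_add_line`, integrality of `L`), and the `E`-DOMINANCE letter `hlam : |μ + jE(f·t₊·(ϖσϖ)^b)| ≤ |jEϖ|^m·|D₀|` (★ p861637's clean-regime letter with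
`|jEϖ|^{2b}` replaced by the honest scale `|D₀|` of the cell) gives `Tr_ρ(μ∕D₀) ≡ jE(f·h_W·t₊·N(ϖ^b·g₀ 1))` modulo `𝔭^m` (§1), whence every value is
`≡ jE(f·h_W·t₊·N(ϖ^b·g₀ 1·a))` (§2) and the letter is `valueSetMod σ ϖ m ((f·h_W) • X₊)` after the unit reparametrisation `a ↦ (ϖ^b g₀ 1)·a` (§3, as in ★ p861637).
(L-K) READING.  `μ = lam − jE u₀₀` is ONE scalar for the whole census and `f` depends on `μ` and the TUBE depth `b` only; the cells `D = (b, b)` and `K₀ = (b+1, b)` share `b`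
and differ in the order parameter `cc` (`ϖE^b` vs `ϖE^{b+1}`), which this HEAD integrates out: in the regime where BOTH cells satisfy `hμt`∕`hlam` (deep `δ`; model (κ-b):
`δ ≥ 8`) every vertex of `K₀` carries the letter of `D` — `K₀` is PURE with the sign of `D`, and `cellDiff_t(K₀)∕cellDiff_t(D)` is the ratio of the weighted sizes
(★ p861491 `ncard_levelSet_near_ramM` ∕ `ncard_levelSet_diag_ramM`: `(q − 1)q^{j−1}` against `q^j`).  The literal enters ONLY through `h_W` (cross-literal: ★ p861637's sibling).
* §1 `v_le_iff_v_inv_mul_le_one`, `v_map_le_map_pow_of_le` (transport of a `ϖ^m`-bound across `jE`), `v_trace_div_sub_main_le` — THE SCALAR ESTIMATE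
  `|Tr_ρ(μ∕D₀) − jE(f·h_W·(t·N(ϖ^b g₁)))| ≤ |jEϖ|^m` from `Tr_ρ(D₀⁻¹) = jE pw`, `|pw + σ(g₁)h_W g₁| ≤ 1`, `|jE(f t (ϖσϖ)^b)| ≤ |jEϖ|^m`, `hlam`.
* §2 `v_normFormTrace_sub_main_le_of_isOrd` — THE PER-VALUE ESTIMATE `|Tr_ρ(μ∕D₀·N_Θ(Yζ + jE a)) − jE(f·h_W·(t·N(ϖ^b g₁ a)))| ≤ |jEϖ|^m` for `ζ ∈ 𝒪_cc`, `|a| ≤ 1`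
  (§1 + ★ p861653 `hsmall_of_isOrd` + ★ p861454 `trace_mul_norm_map_eq`).
* §3 HEAD `valueSet_endoGL_sub_one_glued_eq_smul_xPlus_of_isOrd` — ★ p861372 HEAD B's frame verbatim + the ray-domination letters (`hYO`, `hμ`, `hμt`, `hmm`) + `hft`, `hmb`,
  `hlam` (general scale) ⟹ the value set of `Γ − 1` on `L` is `valueSetMod σ ϖ m ((f·h_W) • xPlus σ ϖ d)`.
WHAT IS NOT CLAIMED: the regime — `hμt` (`μ̃ ∈ 𝒪_cc`: conductor of `lam` at least `j + m′`) and `hlam` (the `M`-part of `μ` below `𝔭^m·D₀`) are the DEEP regime; the rows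
(κ-b) «`K₀ = −D` at `δ = 2d`» and «`K₀,₂ = K₀,₁` at `δ = 4`» (LH4-cdis1 15:32:52Z), where the `M`-part of `μ` reaches the class digit, are NOT instances and stay OPEN.
HONEST LABEL.  Count-neutral lattice ∕ order algebra; nothing printed is asserted; no census law is stated; `HC_CM` is proved only modulo the 7 printed citations (2 remaining
named inputs: hLiu418 = `stmt-HodgeConjecture-24832`, h413 = `stmt-HodgeConjecture-24833`) until rung 0 closes.
## References
* [Jacobowitz1962] R. Jacobowitz, *Hermitian forms over local fields*, Amer. J. Math. 84 (1962): §4 (dual lattices, the pairing `Λ × Λ^♯ → 𝒪`, gluing).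
* [Rogawski1990] J. D. Rogawski, *Automorphic Representations of Unitary Groups in Three Variables*, Ann. of Math. Stud. 123 (1990): §4.9 Prop. 4.9.1 (b) p. 55.
* [Kottwitz1986BaseChangeUnits] R. E. Kottwitz, *Base change for unit elements of Hecke algebras*, Compositio Math. 60 (1986): §1 pp. 240–241.
* [Serre1979] J.-P. Serre, *Local Fields*, GTM 67 (1979): Ch. III §6 Prop. 12 (orders of conductor `c`), Ch. V §3 Cor. 3 (norm classes of units).
* [LanglandsShelstad1987] R. P. Langlands, D. Shelstad, *On the definition of transfer factors*, Math. Ann. 278 (1987): §1–§3 (κ-signs on a stable class).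
-/

set_option autoImplicit false

noncomputable section

namespace Summit.HodgeConjecture.HodgeConjecture.Cruxes.H413.F0P3cDyRamRayDominatedCellLetter

open scoped Valued WithZero Matrix MatrixGroups
open WithZero
open Literature.NumberTheory.Automorphic Literature.NumberTheory.Automorphic.HermitianLattice Literature.NumberTheory.Automorphic.UnitaryLatticeTree
open Literature.NumberTheory.Rogawski1990
open Summit.HodgeConjecture.HodgeConjecture.Cruxes.H413.F0P3cDyRamToricCensusDefs
open Summit.HodgeConjecture.HodgeConjecture.Cruxes.H413.F0P3cDyRamFourFramePieces
open Summit.HodgeConjecture.HodgeConjecture.Cruxes.H413.F0P3cDyRamDepthFormLineModel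
open Summit.HodgeConjecture.HodgeConjecture.Cruxes.H413.F0P3cDyRamDepthScalar (trace_mul_norm_map_eq)
open Summit.HodgeConjecture.HodgeConjecture.Cruxes.H413.F0P3cDyRamNormFormRayDominated (hsmall_of_isOrd)
open Summit.HodgeConjecture.HodgeConjecture.Cruxes.H413.F0P3cDyRamDiagonalCellLetter (v_inv_mul_sub_add_le_one_iff exists_v_le_one_mul_unit_iff v_add_map_le_of_le
  inv_add_map_inv_eq_map_pairing isOrd_zero)
open Summit.HodgeConjecture.HodgeConjecture.Cruxes.H413.F0P3cDyRamBlockGlueLabelFibreConstant (pairing_self_eq_plane_add_line)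
open Summit.HodgeConjecture.HodgeConjecture.Cruxes.H413.F0P3cDyRamSmulXPlusLabel (valueSetMod_smul_xPlus)

variable {E M : Type} [Field E] [Valued E ℤᵐ⁰] [Field M] [Valued M ℤᵐ⁰] {ρ Θ : M →+* M} {α : M}

/-! ## §1 Transport of a `ϖ^m`-bound across `jE`; the scalar estimate `Tr_ρ(μ∕D₀) ≡ jE(f·h_W·t·N(ϖ^b g₁))` modulo `𝔭^m` -/

omit [Field E] [Valued E ℤᵐ⁰] in
/-- `|X| ≤ |P| ↔ |P⁻¹X| ≤ 1` (`P ≠ 0`). [cite: Serre1979, Ch. V §3 Cor. 3] -/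
theorem v_le_iff_v_inv_mul_le_one {P : M} (hP : P ≠ 0) (X : M) : Valued.v X ≤ Valued.v P ↔ Valued.v (P⁻¹ * X) ≤ 1 := by
  rw [Valuation.map_mul, map_inv₀, inv_mul_le_iff₀ (zero_lt_iff.2 ((Valuation.ne_zero_iff _).2 hP)), mul_one]

/-- **TRANSPORT OF A `ϖ^m`-BOUND ACROSS `jE`**: `|x| ≤ |ϖ|^m → |jE x| ≤ |jEϖ|^m` (`ϖ ≠ 0`; `|jE c| ≤ 1 ↔ |c| ≤ 1`; ★ p861372 `v_thicken_iff_map`). [cite: Jacobowitz1962, §4] -/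
theorem v_map_le_map_pow_of_le (jE : E →+* M) (hjv : ∀ c, Valued.v (jE c) ≤ 1 ↔ Valued.v c ≤ 1) {ϖ : E} (hϖ0 : ϖ ≠ 0) {x : E} {m : ℕ}
    (hx : Valued.v x ≤ Valued.v ϖ ^ m) : Valued.v (jE x) ≤ Valued.v (jE ϖ) ^ m := by
  have hϖm0 : ϖ ^ m ≠ 0 := pow_ne_zero _ hϖ0
  have hjϖm0 : jE ϖ ^ m ≠ 0 := pow_ne_zero _ ((map_ne_zero jE).2 hϖ0)
  have h1 : Valued.v ((ϖ ^ m)⁻¹ * (x - 0)) ≤ 1 := by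
    rw [sub_zero, ← v_le_iff_v_inv_mul_le_one hϖm0, Valuation.map_pow]; exact hx
  have h2 := (v_thicken_iff_map jE hjv ϖ m x 0).1 h1
  rwa [map_zero, sub_zero, ← v_le_iff_v_inv_mul_le_one hjϖm0, Valuation.map_pow] at h2

/-- **THE SCALAR ESTIMATE.**  Letters: `ρ` fixes `jE(E)` and is isometric; `D₀ ≠ 0` with `D₀⁻¹ + ρD₀⁻¹ = jE pw` (★ p861637 `inv_add_map_inv_eq_map_pairing`: `pw = ⟨w₀, w₀⟩_{H₂}`);
`|pw + σ(g₁)·h_W·g₁| ≤ 1` (integrality of the glue generator, `g₁ = g₀ 1`); `|jE(f·t·(ϖσϖ)^b)| ≤ |jEϖ|^m`; the `E`-dominance letter `|μ + jE(f·t·(ϖσϖ)^b)| ≤ |jEϖ|^m·|D₀|`.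
THEN `|μ∕D₀ + ρ(μ∕D₀) − jE(f·h_W·(t·N(ϖ^b·g₁)))| ≤ |jEϖ|^m`. [cite: Jacobowitz1962, §4] [cite: Kottwitz1986BaseChangeUnits, §1 pp. 240–241] -/
theorem v_trace_div_sub_main_le (σ : E →+* E) (jE : E →+* M) (hjv : ∀ c, Valued.v (jE c) ≤ 1 ↔ Valued.v c ≤ 1) (hρj : ∀ c, ρ (jE c) = jE c)
    (hvρ : ∀ x, Valued.v (ρ x) = Valued.v x) {D₀ : M} (hD₀0 : D₀ ≠ 0) {pw : E} (hTr : D₀⁻¹ + ρ D₀⁻¹ = jE pw)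
    {g₁ hW : E} (hint : Valued.v (pw + σ g₁ * hW * g₁) ≤ 1)
    {ϖ : E} {m b : ℕ} {f t : E} (hcm : Valued.v (jE (f * t * (ϖ * σ ϖ) ^ b)) ≤ Valued.v (jE ϖ) ^ m)
    {μ : M} (hlam : Valued.v (μ + jE (f * t * (ϖ * σ ϖ) ^ b)) ≤ Valued.v (jE ϖ) ^ m * Valued.v D₀) :
    Valued.v (μ / D₀ + ρ (μ / D₀) - jE (f * hW * (t * ((ϖ ^ b * g₁) * σ (ϖ ^ b * g₁))))) ≤ Valued.v (jE ϖ) ^ m := by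
  obtain ⟨θ, rfl⟩ : ∃ θ : M, μ = θ - jE (f * t * (ϖ * σ ϖ) ^ b) := ⟨μ + jE (f * t * (ϖ * σ ϖ) ^ b), by ring⟩
  rw [sub_add_cancel] at hlam
  have hD₀v : 0 < Valued.v D₀ := zero_lt_iff.2 ((Valuation.ne_zero_iff _).2 hD₀0)
  -- the main term through `pw`: `f·h_W·(t·N(ϖ^b g₁)) = c·(pw + σ(g₁)h_W g₁) − c·pw`, `c = f·t·(ϖσϖ)^b`
  have hmain : f * hW * (t * ((ϖ ^ b * g₁) * σ (ϖ ^ b * g₁))) =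
      f * t * (ϖ * σ ϖ) ^ b * (pw + σ g₁ * hW * g₁) - f * t * (ϖ * σ ϖ) ^ b * pw := by
    rw [map_mul, map_pow]; ring
  have hMn : jE (f * hW * (t * ((ϖ ^ b * g₁) * σ (ϖ ^ b * g₁)))) =
      jE (f * t * (ϖ * σ ϖ) ^ b) * jE (pw + σ g₁ * hW * g₁) - jE (f * t * (ϖ * σ ϖ) ^ b) * (D₀⁻¹ + ρ D₀⁻¹) := by
    rw [hTr, ← map_mul, ← map_mul, ← map_sub, hmain]
  set J : M := jE (f * t * (ϖ * σ ϖ) ^ b) with hJ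
  set I : M := jE (pw + σ g₁ * hW * g₁) with hI
  have hρJ : ρ J = J := hρj _
  have hsplit : (θ - J) / D₀ + ρ ((θ - J) / D₀) - (J * I - J * (D₀⁻¹ + ρ D₀⁻¹)) = (θ / D₀ + ρ (θ / D₀)) + -(J * I) := by
    simp only [div_eq_mul_inv, map_sub, map_mul, map_inv₀, hρJ]
    ring
  rw [hMn, hsplit]
  refine (Valuation.map_add _ _ _).trans (max_le (v_add_map_le_of_le ρ hvρ ?_) ?_)
  · rw [map_div₀, div_le_iff₀ hD₀v]; exact hlam
  · rw [Valuation.map_neg, Valuation.map_mul]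
    calc Valued.v J * Valued.v I ≤ Valued.v (jE ϖ) ^ m * 1 := mul_le_mul' hcm ((hjv _).2 hint)
      _ = Valued.v (jE ϖ) ^ m := mul_one _

/-! ## §2 The per-value estimate on a ray-dominated cell -/

/-- **THE PER-VALUE ESTIMATE.**  Frame of ★ p861653 `hsmall_of_isOrd` (the `ρ`-datum ∕ `Θ` ∕ order letters of ★ DEFS; `Λ = x₀·𝒪_cc` with `Y = dualGen ρ Θ α cc h_M x₀ ∈ 𝒪_cc`;
`μ = jE(ϖ^{m′})·μ̃`, `μ̃ ∈ 𝒪_cc`, `m ≤ m′`; `ϖ ≠ 0`, `|ϖ| ≤ 1`) PLUS the glue letters of §1 at `D₀ = cc(α − ρα)·ΘY` (`D₀⁻¹ + ρD₀⁻¹ = jE pw`, `|pw + σ(g₁)h_W g₁| ≤ 1`,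
`|jE(f t (ϖσϖ)^b)| ≤ |jEϖ|^m`, `|μ + jE(f t (ϖσϖ)^b)| ≤ |jEϖ|^m·|D₀|`).  THEN for `ζ ∈ 𝒪_cc`, `|a| ≤ 1`:
`|Tr_ρ(μ∕D₀·N_Θ(Yζ + jE a)) − jE(f·h_W·(t·N(ϖ^b·g₁·a)))| ≤ |jEϖ|^m`. [cite: Jacobowitz1962, §4] [cite: Rogawski1990, §4.9 Prop. 4.9.1 (b) p. 55]
[cite: Kottwitz1986BaseChangeUnits, §1 pp. 240–241] -/
theorem v_normFormTrace_sub_main_le_of_isOrd (hρρ : ∀ x, ρ (ρ x) = x) (hvρ : ∀ x, Valued.v (ρ x) = Valued.v x) (hα : ρ α ≠ α) (hα1 : Valued.v α ≤ 1)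
    (hintρ : ∀ z : M, Valued.v z ≤ 1 → Valued.v ((z - ρ z) / (α - ρ α)) ≤ 1)
    (hΘΘ : ∀ x, Θ (Θ x) = x) (hΘρ : ∀ x, Θ (ρ x) = ρ (Θ x)) (hvΘ : ∀ x, Valued.v (Θ x) = Valued.v x)
    {cc : M} (hc : ρ cc = cc) (hc0 : cc ≠ 0) (hc1 : Valued.v cc ≤ 1) (hcc : cc * (α - ρ α) ≠ 0) {hM : M} (hh : hM ≠ 0) (hΘh : Θ hM = hM)
    {Λ : AddSubgroup M} {x₀ : M} (hx₀ : x₀ ≠ 0) (hΛ : ∀ x, x ∈ Λ ↔ ∃ z, IsOrd ρ α cc z ∧ x = x₀ * z)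
    (hYO : IsOrd ρ α cc (dualGen ρ Θ α cc hM x₀))
    (σ : E →+* E) (jE : E →+* M) (hjv : ∀ c, Valued.v (jE c) ≤ 1 ↔ Valued.v c ≤ 1) (hΘj : ∀ x, Θ (jE x) = jE (σ x))
    (hjfix : ∀ z, ρ z = z ↔ ∃ c, jE c = z) {ϖ : E} (hϖ0 : ϖ ≠ 0) (hϖ1 : Valued.v ϖ ≤ 1)
    {μ μt : M} {m m' : ℕ} (hμ : μ = jE (ϖ ^ m') * μt) (hμt : IsOrd ρ α cc μt) (hmm : m ≤ m')
    {pw : E} (hTr : (cc * (α - ρ α) * Θ (dualGen ρ Θ α cc hM x₀))⁻¹ + ρ (cc * (α - ρ α) * Θ (dualGen ρ Θ α cc hM x₀))⁻¹ = jE pw)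
    {g₁ hW : E} (hint : Valued.v (pw + σ g₁ * hW * g₁) ≤ 1)
    {b : ℕ} {f t : E} (hcm : Valued.v (jE (f * t * (ϖ * σ ϖ) ^ b)) ≤ Valued.v (jE ϖ) ^ m)
    (hlam : Valued.v (μ + jE (f * t * (ϖ * σ ϖ) ^ b)) ≤ Valued.v (jE ϖ) ^ m * Valued.v (cc * (α - ρ α) * Θ (dualGen ρ Θ α cc hM x₀)))
    {ζ : M} (hζ : IsOrd ρ α cc ζ) {a : E} (ha : Valued.v a ≤ 1) :
    Valued.v (μ / (cc * (α - ρ α) * Θ (dualGen ρ Θ α cc hM x₀)) * ((dualGen ρ Θ α cc hM x₀ * ζ + jE a) * Θ (dualGen ρ Θ α cc hM x₀ * ζ + jE a)) +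
        ρ (μ / (cc * (α - ρ α) * Θ (dualGen ρ Θ α cc hM x₀)) * ((dualGen ρ Θ α cc hM x₀ * ζ + jE a) * Θ (dualGen ρ Θ α cc hM x₀ * ζ + jE a))) -
        jE (f * hW * (t * ((ϖ ^ b * g₁ * a) * σ (ϖ ^ b * g₁ * a))))) ≤ Valued.v (jE ϖ) ^ m := by
  set Y : M := dualGen ρ Θ α cc hM x₀ with hYdef
  set D₀ : M := cc * (α - ρ α) * Θ Y with hD₀def
  have hρj : ∀ c : E, ρ (jE c) = jE c := fun c => (hjfix _).2 ⟨c, rfl⟩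
  have hY0 : Y ≠ 0 := by
    rw [hYdef, dualGen_def]; exact mul_ne_zero (mul_ne_zero hh (mul_ne_zero hx₀ ((map_ne_zero Θ).2 hx₀))) hcc
  have hD₀0 : D₀ ≠ 0 := mul_ne_zero hcc ((map_ne_zero Θ).2 hY0)
  have hjϖm0 : jE ϖ ^ m ≠ 0 := pow_ne_zero _ ((map_ne_zero jE).2 hϖ0)
  -- (1) the `ζ`-part is `ϖ^m`-small (★ p861653)
  have h1 := hsmall_of_isOrd hρρ hvρ hα hα1 hintρ hΘΘ hΘρ hvΘ hc hc0 hc1 hcc hh hΘh hx₀ hΛ hYO jE hjv hΘj hjfix hϖ1 hμ hμt hmm ζ a hζ ha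
  rw [← v_le_iff_v_inv_mul_le_one hjϖm0, Valuation.map_pow] at h1
  -- (2) the ray value `Tr_ρ(μ∕D₀·N_Θ(jE a)) = jE(N a)·Tr_ρ(μ∕D₀)` (★ p861454)
  have h2 := trace_mul_norm_map_eq (ρ := ρ) (Θ := Θ) σ jE hΘj hjfix (μ / D₀) Y a
  -- (3) the scalar estimate (§1)
  have h3 := v_trace_div_sub_main_le σ jE hjv hρj hvρ hD₀0 hTr hint hcm hlam
  -- the main term is `jE(N a)` times the scalar main term
  have hma : jE (f * hW * (t * ((ϖ ^ b * g₁ * a) * σ (ϖ ^ b * g₁ * a)))) =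
      jE (a * σ a) * jE (f * hW * (t * ((ϖ ^ b * g₁) * σ (ϖ ^ b * g₁)))) := by
    rw [← map_mul]; congr 1; rw [map_mul σ (ϖ ^ b * g₁) a]; ring
  have hNa : Valued.v (jE (a * σ a)) ≤ 1 := by
    refine (hjv _).2 ?_
    rw [Valuation.map_mul]
    have hσa : Valued.v (σ a) ≤ 1 := by
      have h := (hjv (σ a)).1; rw [← hΘj, hvΘ] at h; exact h ((hjv a).2 ha)
    calc Valued.v a * Valued.v (σ a) ≤ 1 * 1 := mul_le_mul' ha hσa
      _ = 1 := mul_one _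
  have e : μ / D₀ * ((Y * ζ + jE a) * Θ (Y * ζ + jE a)) + ρ (μ / D₀ * ((Y * ζ + jE a) * Θ (Y * ζ + jE a))) -
      jE (f * hW * (t * ((ϖ ^ b * g₁ * a) * σ (ϖ ^ b * g₁ * a)))) =
      (μ / D₀ * ((Y * ζ + jE a) * Θ (Y * ζ + jE a)) + ρ (μ / D₀ * ((Y * ζ + jE a) * Θ (Y * ζ + jE a))) -
          (μ / D₀ * ((Y * 0 + jE a) * Θ (Y * 0 + jE a)) + ρ (μ / D₀ * ((Y * 0 + jE a) * Θ (Y * 0 + jE a))))) +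
        jE (a * σ a) * (μ / D₀ + ρ (μ / D₀) - jE (f * hW * (t * ((ϖ ^ b * g₁) * σ (ϖ ^ b * g₁))))) := by
    rw [h2, hma]; ring
  rw [e]
  refine (Valuation.map_add _ _ _).trans (max_le h1 ?_)
  rw [Valuation.map_mul]
  calc Valued.v (jE (a * σ a)) * _ ≤ 1 * Valued.v (jE ϖ) ^ m := mul_le_mul' hNa h3
    _ = Valued.v (jE ϖ) ^ m := one_mul _

/-! ## §3 HEAD — the letter of an integral glued vertex over a ray-dominated cell is `valueSetMod σ ϖ m ((f·h_W) • X₊)` -/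

/-- **HEAD — «THE LETTER OF A RAY-DOMINATED CELL IS `(f·h_W) • X₊`».**  Frame of ★ p861372 HEAD B `valueSet_endoGL_sub_one_glued_eq_normFormSet_of_gen` VERBATIM (the plane
`(E², H₂)` with `σ` isometric, `|ϖ| = exp(−1)`, block form `H = block(H₂, h_W)`, `Γ = endoGL (γ₂, u)` with `|u₀₀ − 1| ≤ |ϖ^m|`; ★ (C1)'s line model `(M, jE, ρ, Θ; φ, lam, h_M)`
with `Θh_M = h_M`; an INTEGRAL vertex `L` glued over `(B₂, w₀)` with generator `g₀`, `|g₀ 1|·|ϖ|^b = 1`; the presentation `φ(B₂) = Λ = x₀·𝒪_cc`, `φ w₀ = Y⁻¹x₀`,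
`Y = dualGen ρ Θ α cc h_M x₀`) PLUS the `ρ`-datum ∕ `Θ` ∕ order letters of ★ DEFS (`hρρ hvρ hα hα1 hintρ hΘΘ hΘρ hvΘ hΘj hjfix`, `ρcc = cc`, `0 < |cc| ≤ 1`) PLUS the
RAY-DOMINATION letters of ★ p861653 (`hYO : Y ∈ 𝒪_cc`; `hμ : lam − jE u₀₀ = jE(ϖ^{m′})·μ̃`, `hμt : μ̃ ∈ 𝒪_cc`, `hmm : m ≤ m′`) PLUS `|f·t₊| ≤ 1`, `m ≤ 2b` and the
`E`-DOMINANCE letter at the scale of the cell `hlam : |lam − jE u₀₀ + jE(f·t₊·(ϖσϖ)^b)| ≤ |jEϖ|^m·|cc(α − ρα)·ΘY|` (`t₊ = (ϖ − σϖ)·((ϖσϖ)^{⌊d∕2⌋})⁻¹`).  THEN the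
`ϖ^m`-value set of `Γ − 1` on `L` is `valueSetMod σ ϖ m ((f·h_W) • xPlus σ ϖ d)` — on the diagonal cell, on the near cell `K₀`, at a place of any type: NO valuation letter
of `Y`, `cc(α − ρα)` or `D₀` is used. [cite: Jacobowitz1962, §4] [cite: Rogawski1990, §4.9 Prop. 4.9.1 (b) p. 55] [cite: Kottwitz1986BaseChangeUnits, §1 pp. 240–241]
[cite: LanglandsShelstad1987, §1–§3] -/
theorem valueSet_endoGL_sub_one_glued_eq_smul_xPlus_of_isOrd (σ : E →+* E) (hvσ : ∀ a, Valued.v (σ a) = Valued.v a) {ϖ : E} (hϖ : Valued.v ϖ = exp (-1 : ℤ))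
    (H₂ : Matrix (Fin 2) (Fin 2) E) (h : E) (d : ℕ)
    (jE : E →+* M) (hjv : ∀ c, Valued.v (jE c) ≤ 1 ↔ Valued.v c ≤ 1) (hjfix : ∀ z, ρ z = z ↔ ∃ c, jE c = z)
    (hρρ : ∀ x, ρ (ρ x) = x) (hvρ : ∀ x, Valued.v (ρ x) = Valued.v x) (hα : ρ α ≠ α) (hα1 : Valued.v α ≤ 1)
    (hintρ : ∀ z : M, Valued.v z ≤ 1 → Valued.v ((z - ρ z) / (α - ρ α)) ≤ 1)
    (hΘΘ : ∀ x, Θ (Θ x) = x) (hΘρ : ∀ x, Θ (ρ x) = ρ (Θ x)) (hvΘ : ∀ x, Valued.v (Θ x) = Valued.v x) (hΘj : ∀ c, Θ (jE c) = jE (σ c))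
    (φ : (Fin 2 → E) →+ M) (hφs : ∀ (c : E) (x : Fin 2 → E), φ (c • x) = jE c * φ x)
    {γ₂ : GL (Fin 2) E} {lam hM : M} (hφγ : ∀ x, φ ((γ₂ : Matrix (Fin 2) (Fin 2) E) *ᵥ x) = lam * φ x) (hhM : hM ≠ 0) (hΘh : Θ hM = hM)
    (hform : ∀ x y, jE (pairing σ H₂ x y) = hM * Θ (φ x) * φ y + ρ (hM * Θ (φ x) * φ y))
    {L : Submodule 𝒪[E] (Fin 3 → E)} {b : ℕ} (hpr : ∀ x ∈ L, Valued.v (x 1) * Valued.v ϖ ^ b ≤ 1)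
    (hint : ∀ y ∈ L, Valued.v (pairing σ (!![H₂ 0 0, 0, H₂ 0 1; 0, h, 0; H₂ 1 0, 0, H₂ 1 1] : Matrix (Fin 3) (Fin 3) E) y y) ≤ 1)
    {B₂ : Submodule 𝒪[E] (Fin 2 → E)} {w₀ : Fin 2 → E} {g₀ : Fin 3 → E}
    (hB : B₂.map ((Matrix.toLin' (!![1, 0; 0, 0; 0, 1] : Matrix (Fin 3) (Fin 2) E)).restrictScalars 𝒪[E]) =
      L ⊓ LinearMap.ker ((LinearMap.proj (1 : Fin 3) : (Fin 3 → E) →ₗ[E] E).restrictScalars 𝒪[E]))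
    (hg₀ : g₀ ∈ L) (hg₀1 : Valued.v (g₀ 1) * Valued.v ϖ ^ b = 1) (hprg : g₀ - Pi.single 1 (g₀ 1) = ![w₀ 0, 0, w₀ 1])
    (u : GL (Fin 1) E) (m : ℕ) (hum : Valued.v ((u : Matrix (Fin 1) (Fin 1) E) 0 0 - 1) ≤ Valued.v (ϖ ^ m))
    {cc x₀ : M} (hc : ρ cc = cc) (hc0 : cc ≠ 0) (hc1 : Valued.v cc ≤ 1) (hcc : cc * (α - ρ α) ≠ 0) (hx₀ : x₀ ≠ 0)
    {Λ : AddSubgroup M} (hBΛ : B₂.toAddSubgroup.map φ = Λ)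
    (hΛx : ∀ x, x ∈ Λ ↔ ∃ ζ, IsOrd ρ α cc ζ ∧ x = x₀ * ζ) (hw₀Y : φ w₀ = (dualGen ρ Θ α cc hM x₀)⁻¹ * x₀)
    -- the ray-domination letters (★ p861653)
    (hYO : IsOrd ρ α cc (dualGen ρ Θ α cc hM x₀))
    {μt : M} {m' : ℕ} (hμ : lam - jE ((u : Matrix (Fin 1) (Fin 1) E) 0 0) = jE (ϖ ^ m') * μt) (hμt : IsOrd ρ α cc μt) (hmm : m ≤ m')
    -- the `E`-dominance letter at the scale of the cell
    (hmb : m ≤ 2 * b) (f : E) (hft : Valued.v (f * ((ϖ - σ ϖ) * ((ϖ * σ ϖ) ^ ((d - d % 2) / 2))⁻¹)) ≤ 1)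
    (hlam : Valued.v (lam - jE ((u : Matrix (Fin 1) (Fin 1) E) 0 0) + jE (f * ((ϖ - σ ϖ) * ((ϖ * σ ϖ) ^ ((d - d % 2) / 2))⁻¹) * (ϖ * σ ϖ) ^ b)) ≤
      Valued.v (jE ϖ) ^ m * Valued.v (cc * (α - ρ α) * Θ (dualGen ρ Θ α cc hM x₀))) :
    {z : E | ∃ y ∈ L, Valued.v ((ϖ ^ m)⁻¹ * (z - pairing σ (!![H₂ 0 0, 0, H₂ 0 1; 0, h, 0; H₂ 1 0, 0, H₂ 1 1] : Matrix (Fin 3) (Fin 3) E) y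
        ((((endoGL (γ₂, u) : GL (Fin 3) E) : Matrix (Fin 3) (Fin 3) E) - 1) *ᵥ y))) ≤ 1} =
      valueSetMod σ ϖ m ((f * h) • xPlus σ ϖ d) := by
  rw [valueSet_endoGL_sub_one_glued_eq_normFormSet_of_gen σ hϖ H₂ h jE hjv hΘΘ φ hφs hφγ hhM hform hpr hint hB hg₀ hg₀1 hprg u m hum hcc hx₀ hBΛ hΛx hw₀Y,
    valueSetMod_smul_xPlus]
  -- names
  set Y : M := dualGen ρ Θ α cc hM x₀ with hYdef
  set D₀ : M := cc * (α - ρ α) * Θ Y with hD₀def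
  set μ : M := lam - jE ((u : Matrix (Fin 1) (Fin 1) E) 0 0) with hμdef
  set t : E := (ϖ - σ ϖ) * ((ϖ * σ ϖ) ^ ((d - d % 2) / 2))⁻¹ with htdef
  have hvϖ0 : Valued.v ϖ ≠ 0 := by rw [hϖ]; exact WithZero.exp_ne_zero
  have hϖ0 : ϖ ≠ 0 := fun h0 => by rw [h0, map_zero] at hvϖ0; exact hvϖ0 rfl
  have hϖ1 : Valued.v ϖ ≤ 1 := by rw [hϖ, ← WithZero.exp_zero, WithZero.exp_le_exp]; norm_num
  have hρj : ∀ c : E, ρ (jE c) = jE c := fun c => (hjfix _).2 ⟨c, rfl⟩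
  -- the glue letters: `Tr_ρ(D₀⁻¹) = jE⟨w₀,w₀⟩`, integrality of `g₀`, the unit `ϖ^b·g₀ 1`
  have hTr : D₀⁻¹ + ρ D₀⁻¹ = jE (pairing σ H₂ w₀ w₀) := inv_add_map_inv_eq_map_pairing σ H₂ jE hΘΘ φ hhM hform hcc hx₀ hw₀Y
  have hw₀g : (![g₀ 0, g₀ 2] : Fin 2 → E) = w₀ := by
    have h0 := congrFun hprg 0
    have h2 := congrFun hprg 2
    simp only [Pi.sub_apply, Pi.single_apply] at h0 h2
    ext i; fin_cases i <;> simp_all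
  have hintg : Valued.v (pairing σ H₂ w₀ w₀ + σ (g₀ 1) * h * g₀ 1) ≤ 1 := by
    have h1 := hint g₀ hg₀
    rwa [pairing_self_eq_plane_add_line σ H₂ h g₀, hw₀g] at h1
  have hu₀ : Valued.v (ϖ ^ b * g₀ 1) = 1 := by rw [Valuation.map_mul, Valuation.map_pow, mul_comm]; exact hg₀1
  -- `|jE(f·t·(ϖσϖ)^b)| ≤ |jEϖ|^m` from `|f t| ≤ 1`, `m ≤ 2b`
  have hcm : Valued.v (jE (f * t * (ϖ * σ ϖ) ^ b)) ≤ Valued.v (jE ϖ) ^ m := by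
    refine v_map_le_map_pow_of_le jE hjv hϖ0 ?_
    have hϖσ : Valued.v ((ϖ * σ ϖ) ^ b) = Valued.v ϖ ^ (2 * b) := by
      rw [Valuation.map_pow, Valuation.map_mul, hvσ, ← pow_two, ← pow_mul]
    rw [Valuation.map_mul, hϖσ]
    calc Valued.v (f * t) * Valued.v ϖ ^ (2 * b) ≤ 1 * Valued.v ϖ ^ m := mul_le_mul' hft (pow_le_pow_right_of_le_one' hϖ1 hmb)
      _ = Valued.v ϖ ^ m := one_mul _
  -- the two sides, member by member
  ext z
  simp only [Set.mem_setOf_eq]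
  rw [← exists_v_le_one_mul_unit_iff hu₀ (fun a => Valued.v ((ϖ ^ m)⁻¹ * (z - f * h * (t * (a * σ a)))) ≤ 1)]
  have hkey : ∀ (ζ : M) (a : E), IsOrd ρ α cc ζ → Valued.v a ≤ 1 →
      (Valued.v ((jE ϖ ^ m)⁻¹ * (jE z - (μ * ((Y * ζ + jE a) * Θ (Y * ζ + jE a)) / D₀ + ρ (μ * ((Y * ζ + jE a) * Θ (Y * ζ + jE a)) / D₀)))) ≤ 1 ↔
        Valued.v ((ϖ ^ m)⁻¹ * (z - f * h * (t * ((ϖ ^ b * g₀ 1 * a) * σ (ϖ ^ b * g₀ 1 * a))))) ≤ 1) := by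
    intro ζ a hζ ha
    have hest := v_normFormTrace_sub_main_le_of_isOrd hρρ hvρ hα hα1 hintρ hΘΘ hΘρ hvΘ hc hc0 hc1 hcc hhM hΘh hx₀ hΛx hYO σ jE hjv hΘj hjfix hϖ0 hϖ1
      hμ hμt hmm hTr hintg (hW := h) hcm hlam hζ ha
    rw [mul_div_right_comm μ _ D₀]
    set V : M := μ / D₀ * ((Y * ζ + jE a) * Θ (Y * ζ + jE a)) + ρ (μ / D₀ * ((Y * ζ + jE a) * Θ (Y * ζ + jE a))) with hV
    set V₀ : E := f * h * (t * ((ϖ ^ b * g₀ 1 * a) * σ (ϖ ^ b * g₀ 1 * a))) with hV₀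
    have hsplit : V = jE V₀ + (V - jE V₀) := by ring
    rw [hsplit, v_inv_mul_sub_add_le_one_iff (pow_ne_zero _ ((map_ne_zero jE).2 hϖ0)) (by rw [Valuation.map_pow]; exact hest),
      ← v_thicken_iff_map jE hjv]
  constructor
  · rintro ⟨ζ, a, hζ, ha, hz⟩
    exact ⟨a, ha, (hkey ζ a hζ ha).1 hz⟩
  · rintro ⟨a, ha, hz⟩
    exact ⟨0, a, isOrd_zero ρ α cc, ha, (hkey 0 a (isOrd_zero ρ α cc) ha).2 hz⟩

end Summit.HodgeConjecture.HodgeConjecture.Cruxes.H413.F0P3cDyRamRayDominatedCellLetter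

end
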